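import Summits.CriticalPhenomena.CardyFormulaZ2.Theorems.CardyBoundaryCoulombGasRectilinearCardyClosureDefs
import Summits.CriticalPhenomena.CardyFormulaZ2.Theorems.RectilinearCardy.Negative.RectilinearCardyReductions
import Literature.Probability.Percolation.LatticeSymmetry
import Literature.Probability.Percolation.BondPercolationSymmetry
import HarnessLib

/-!
# Stub stub_conjDensity of line excursion-kernel-covariance (crux RectilinearCardy, stmt-CriticalPhenomena-5660):
# the closure density is reflection-invariant

For a conformal rectangle `R` and its complex-conjugate copy `R'` (`z ∈ R'.carrier ↔ conj z ∈ R.carrier`,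
`R'.boundary = conj ∘ R.boundary`, same marks) and the lattice reflection `σ v = (v₀, -v₁)` of `ℤ²`,
the CLOSURE DENSITY `d_δ(v) = P_{1/2}[{v ↔ rowArc in V_δ} ∖ {rowBeyond v ↔ rowArc in V_δ}]` of the
line's third definitions module (`…RectilinearCardyClosureDefs`) is invariant:
`closureDensity R' δ (σ v) = closureDensity R δ v`.

Proof. (1) Geometry: `δ σw = conj (δ w)` and `conj` is an isometric involution of `ℂ` carrying
`closure Ω`, `frontier Ω`, the arc `(ab) = R.arc 0` and the tail arcs `∂Ω[s, d]` of `R` onto those of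
`R'`; hence every finset of the construction transfers along `σ`: `w ∈ X(R') ↔ σ w ∈ X(R)` for
`X = closureFinset, boundaryRow, rowArc, rowTail s, rowBeyond` (`σ` is the vertex map of the graph
automorphism `reflectIso 1` of `ℤ²`, so "exactly one neighbour outside" is preserved), i.e.
`X(R') = σ '' X(R)`. (2) Percolation: the open crossing events of the image sets pull back along the
relabelling `ω ↦ σ '' ω` to the original events (`preimage_relabel_openCrossing`), and `P_{1/2}` on
`ℤ²` is invariant under this relabelling (`bondPercolation_real_preimage_relabel_iso`, Grimmett 1999
§1.6). The degenerate meshes `δ ≤ 0` need no separate treatment (all finsets are empty on both sides).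
-/

noncomputable section

open Set Filter Topology MeasureTheory Metric
open Literature.Probability.RandomPlanarGeometry
open Literature.Probability.LatticeModels (Site meshPoint zdGraph)
open Summit.CriticalPhenomena.CardyFormulaZ2.Theorems.RectilinearCardy.Negative (IsRectilinear)
open Literature.Probability.Percolation (bondPercolation half openCrossing openConnIn reflectIso
  preimage_relabel_openCrossing bondPercolation_real_preimage_relabel_iso)

namespace Summit.CriticalPhenomena.CardyFormulaZ2.Cruxes.RectilinearCardy.ExcursionKernelCovariance

/-! ### The lattice reflection `σ v = (v₀, -v₁)`

Throughout, `σ` is the vertex map `(reflectIso (1 : Fin 2)).toEquiv` of the tree's graph automorphism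
`reflectIso 1` of `zdGraph 2`, written out in full so that the relabelling lemmas of
`LatticeSymmetry.lean` / `BondPercolationSymmetry.lean` apply verbatim. -/

/-- `σ v = (v₀, -v₁)` in coordinates. [folklore] -/
private theorem refl_apply (w : Site 2) : (reflectIso (1 : Fin 2)).toEquiv w = ![w 0, -w 1] := by
  ext i
  fin_cases i <;> simp

/-- `σ` is an involution. [folklore] -/
private theorem refl_refl (w : Site 2) :
    (reflectIso (1 : Fin 2)).toEquiv ((reflectIso (1 : Fin 2)).toEquiv w) = w := by
  rw [refl_apply, refl_apply]
  ext i
  fin_cases i <;> simp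

/-- `σ⁻¹ = σ`. [folklore] -/
private theorem refl_symm_apply (w : Site 2) :
    (reflectIso (1 : Fin 2)).toEquiv.symm w = (reflectIso (1 : Fin 2)).toEquiv w := by
  rw [Equiv.symm_apply_eq, refl_refl]

/-- `w = σ v ↔ σ w = v`. [folklore] -/
private theorem eq_refl_iff (v w : Site 2) :
    w = (reflectIso (1 : Fin 2)).toEquiv v ↔ (reflectIso (1 : Fin 2)).toEquiv w = v := by
  rw [← refl_symm_apply, Equiv.eq_symm_apply]

/-- `σ` is a graph automorphism of `ℤ²` (it is `reflectIso 1`). [folklore] -/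
private theorem adj_refl_iff (v w : Site 2) :
    (zdGraph 2).Adj ((reflectIso (1 : Fin 2)).toEquiv v) ((reflectIso (1 : Fin 2)).toEquiv w) ↔
      (zdGraph 2).Adj v w :=
  (reflectIso (1 : Fin 2)).map_rel_iff'

/-- Membership in a `σ`-image: `w ∈ σ '' X ↔ σ w ∈ X`. [folklore] -/
private theorem mem_image_refl {X : Set (Site 2)} {w : Site 2} :
    w ∈ (reflectIso (1 : Fin 2)).toEquiv '' X ↔ (reflectIso (1 : Fin 2)).toEquiv w ∈ X := by
  rw [Equiv.image_eq_preimage_symm, Set.mem_preimage, refl_symm_apply]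

/-- A membership transfer `w ∈ X' ↔ σ w ∈ X` is the set identity `X' = σ '' X`. [folklore] -/
private theorem coe_eq_image_refl {X X' : Finset (Site 2)}
    (h : ∀ w, w ∈ X' ↔ (reflectIso (1 : Fin 2)).toEquiv w ∈ X) :
    (↑X' : Set (Site 2)) = (reflectIso (1 : Fin 2)).toEquiv '' ↑X := by
  ext w
  rw [mem_image_refl, Finset.mem_coe, Finset.mem_coe, h]

/-- Mesh points under `σ`: `δ σw = conj (δ w)`. [folklore] -/
private theorem meshPoint_refl (δ : ℝ) (w : Site 2) :
    meshPoint δ ((reflectIso (1 : Fin 2)).toEquiv w) = (starRingEnd ℂ) (meshPoint δ w) := by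
  rw [refl_apply]
  apply Complex.ext <;>
    simp [Literature.Probability.LatticeModels.meshPoint_re, Literature.Probability.LatticeModels.meshPoint_im]

/-! ### Plane geometry of the conjugate rectangle -/

variable {R R' : ConformalRectangle}

/-- `z ∈ Ω̄' ↔ conj z ∈ Ω̄` (closure of a Jordan domain = domain ∪ boundary loop). [folklore] -/
private theorem mem_closure_conj (hcar : ∀ z : ℂ, z ∈ R'.carrier ↔ (starRingEnd ℂ) z ∈ R.carrier)
    (hbd : ∀ t : ℝ, R'.boundary t = (starRingEnd ℂ) (R.boundary t)) (z : ℂ) :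
    z ∈ closure R'.carrier ↔ (starRingEnd ℂ) z ∈ closure R.carrier := by
  rw [R'.closure_eq, R.closure_eq, Set.mem_union, Set.mem_union, hcar, Set.mem_range, Set.mem_range]
  simp only [hbd]
  exact or_congr_right (exists_congr fun t =>
    ⟨fun h => by rw [← h, Complex.conj_conj], fun h => by rw [h, Complex.conj_conj]⟩)

/-- `∂Ω' = conj '' ∂Ω` (both are the ranges of the boundary loops). [folklore] -/
private theorem frontier_conj (hbd : ∀ t : ℝ, R'.boundary t = (starRingEnd ℂ) (R.boundary t)) :
    frontier R'.carrier = (starRingEnd ℂ) '' frontier R.carrier := by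
  rw [← R'.range_boundary, ← R.range_boundary, ← Set.range_comp]
  exact congrArg Set.range (funext hbd)

/-- Boundary images: `∂Ω' '' I = conj '' (∂Ω '' I)`. [folklore] -/
private theorem image_boundary_conj (hbd : ∀ t : ℝ, R'.boundary t = (starRingEnd ℂ) (R.boundary t))
    (I : Set ℝ) : R'.boundary '' I = (starRingEnd ℂ) '' (R.boundary '' I) := by
  rw [Set.image_image]
  exact Set.image_congr fun t _ => hbd t

/-- Same marks, same next marks. [folklore] -/
private theorem nextMark_conj (hmk : ∀ i : Fin 4, R'.mark i = R.mark i) (i : Fin 4) :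
    R'.nextMark i = R.nextMark i := by
  have h : R'.mark = R.mark := funext hmk
  unfold MarkedDomain.nextMark
  rw [h]

/-- The arcs of `R'` are the conjugates of the arcs of `R`. [folklore] -/
private theorem arc_conj (hbd : ∀ t : ℝ, R'.boundary t = (starRingEnd ℂ) (R.boundary t))
    (hmk : ∀ i : Fin 4, R'.mark i = R.mark i) (i : Fin 4) :
    R'.arc i = (starRingEnd ℂ) '' R.arc i := by
  unfold MarkedDomain.arc
  rw [nextMark_conj hmk, hmk, image_boundary_conj hbd]

/-- The tail arcs of `R'` are the conjugates of the tail arcs of `R`. [folklore] -/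
private theorem tailArc_conj (hbd : ∀ t : ℝ, R'.boundary t = (starRingEnd ℂ) (R.boundary t))
    (hmk : ∀ i : Fin 4, R'.mark i = R.mark i) (s : ℝ) :
    tailArc R' s = (starRingEnd ℂ) '' tailArc R s := by
  unfold tailArc
  rw [hmk, image_boundary_conj hbd]

/-- `conj` is an isometric involution: `infDist z (conj '' A) = infDist (conj z) A`. [folklore] -/
private theorem infDist_conj_image (z : ℂ) (A : Set ℂ) :
    infDist z ((starRingEnd ℂ) '' A) = infDist ((starRingEnd ℂ) z) A := by
  have h := Metric.infDist_image (x := (starRingEnd ℂ) z) (t := A) Complex.isometry_conj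
  rwa [Complex.conj_conj] at h

/-- Smirnov's closest-arc comparison transfers along `conj` / `σ`. [folklore] -/
private theorem infDist_le_conj_iff (hbd : ∀ t : ℝ, R'.boundary t = (starRingEnd ℂ) (R.boundary t))
    (A : Set ℂ) (δ : ℝ) (w : Site 2) :
    infDist (meshPoint δ w) ((starRingEnd ℂ) '' A) ≤
        infDist (meshPoint δ w) (frontier R'.carrier \ (starRingEnd ℂ) '' A) ↔
      infDist (meshPoint δ ((reflectIso (1 : Fin 2)).toEquiv w)) A ≤
        infDist (meshPoint δ ((reflectIso (1 : Fin 2)).toEquiv w)) (frontier R.carrier \ A) := by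
  rw [frontier_conj hbd, ← Set.image_sdiff (starRingEnd ℂ).injective, infDist_conj_image,
    infDist_conj_image, meshPoint_refl]

/-! ### The finsets of the construction transfer along `σ` -/

/-- `w ∈ V_δ(R') ↔ σ w ∈ V_δ(R)`. [folklore] -/
private theorem mem_closureFinset_conj
    (hcar : ∀ z : ℂ, z ∈ R'.carrier ↔ (starRingEnd ℂ) z ∈ R.carrier)
    (hbd : ∀ t : ℝ, R'.boundary t = (starRingEnd ℂ) (R.boundary t)) (δ : ℝ) (w : Site 2) :
    w ∈ closureFinset R' δ ↔ (reflectIso (1 : Fin 2)).toEquiv w ∈ closureFinset R δ := by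
  rcases le_or_gt δ 0 with hδ | hδ
  · rw [closureFinset_of_nonpos R' hδ, closureFinset_of_nonpos R hδ]
    simp
  · rw [mem_closureFinset_iff R' hδ, mem_closureFinset_iff R hδ, meshPoint_refl]
    exact mem_closure_conj hcar hbd _

/-- The number of lattice neighbours outside `V_δ` is `σ`-invariant. [folklore] -/
private theorem card_filter_conj
    (hcar : ∀ z : ℂ, z ∈ R'.carrier ↔ (starRingEnd ℂ) z ∈ R.carrier)
    (hbd : ∀ t : ℝ, R'.boundary t = (starRingEnd ℂ) (R.boundary t)) (δ : ℝ) (w : Site 2) :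
    (((zdGraph 2).neighborFinset w).filter fun u => u ∉ closureFinset R' δ).card =
      (((zdGraph 2).neighborFinset ((reflectIso (1 : Fin 2)).toEquiv w)).filter
        fun u => u ∉ closureFinset R δ).card := by
  refine Finset.card_equiv (reflectIso (1 : Fin 2)).toEquiv fun u => ?_
  rw [Finset.mem_filter, Finset.mem_filter, SimpleGraph.mem_neighborFinset,
    SimpleGraph.mem_neighborFinset, adj_refl_iff, mem_closureFinset_conj hcar hbd]

/-- `w ∈ boundaryRow R' δ ↔ σ w ∈ boundaryRow R δ`. [folklore] -/
private theorem mem_boundaryRow_conj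
    (hcar : ∀ z : ℂ, z ∈ R'.carrier ↔ (starRingEnd ℂ) z ∈ R.carrier)
    (hbd : ∀ t : ℝ, R'.boundary t = (starRingEnd ℂ) (R.boundary t)) (δ : ℝ) (w : Site 2) :
    w ∈ boundaryRow R' δ ↔ (reflectIso (1 : Fin 2)).toEquiv w ∈ boundaryRow R δ := by
  rw [mem_boundaryRow_iff, mem_boundaryRow_iff, mem_closureFinset_conj hcar hbd,
    card_filter_conj hcar hbd]

/-- `w ∈ rowArc R' δ ↔ σ w ∈ rowArc R δ`. [folklore] -/
private theorem mem_rowArc_conj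
    (hcar : ∀ z : ℂ, z ∈ R'.carrier ↔ (starRingEnd ℂ) z ∈ R.carrier)
    (hbd : ∀ t : ℝ, R'.boundary t = (starRingEnd ℂ) (R.boundary t))
    (hmk : ∀ i : Fin 4, R'.mark i = R.mark i) (δ : ℝ) (w : Site 2) :
    w ∈ rowArc R' δ ↔ (reflectIso (1 : Fin 2)).toEquiv w ∈ rowArc R δ := by
  rw [mem_rowArc_iff, mem_rowArc_iff, mem_boundaryRow_conj hcar hbd, arc_conj hbd hmk,
    infDist_le_conj_iff hbd]

/-- `w ∈ rowTail R' δ s ↔ σ w ∈ rowTail R δ s`. [folklore] -/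
private theorem mem_rowTail_conj
    (hcar : ∀ z : ℂ, z ∈ R'.carrier ↔ (starRingEnd ℂ) z ∈ R.carrier)
    (hbd : ∀ t : ℝ, R'.boundary t = (starRingEnd ℂ) (R.boundary t))
    (hmk : ∀ i : Fin 4, R'.mark i = R.mark i) (δ s : ℝ) (w : Site 2) :
    w ∈ rowTail R' δ s ↔ (reflectIso (1 : Fin 2)).toEquiv w ∈ rowTail R δ s := by
  rw [mem_rowTail_iff, mem_rowTail_iff, mem_boundaryRow_conj hcar hbd, tailArc_conj hbd hmk,
    infDist_le_conj_iff hbd]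

/-- `w ∈ rowBeyond R' δ (σ v) ↔ σ w ∈ rowBeyond R δ v`. [folklore] -/
private theorem mem_rowBeyond_conj
    (hcar : ∀ z : ℂ, z ∈ R'.carrier ↔ (starRingEnd ℂ) z ∈ R.carrier)
    (hbd : ∀ t : ℝ, R'.boundary t = (starRingEnd ℂ) (R.boundary t))
    (hmk : ∀ i : Fin 4, R'.mark i = R.mark i) (δ : ℝ) (v w : Site 2) :
    w ∈ rowBeyond R' δ ((reflectIso (1 : Fin 2)).toEquiv v) ↔
      (reflectIso (1 : Fin 2)).toEquiv w ∈ rowBeyond R δ v := by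
  rw [mem_rowBeyond_iff, mem_rowBeyond_iff, mem_boundaryRow_conj hcar hbd, hmk, hmk]
  simp only [ne_eq, eq_refl_iff, mem_rowTail_conj hcar hbd hmk, refl_refl]

/-! ### The percolation side: relabelling invariance of `P_{1/2}` -/

/-- `P_{1/2}` of a difference of open crossing events of `σ`-images equals that of the original
difference (`preimage_relabel_openCrossing` + `bondPercolation_real_preimage_relabel_iso`, the
lattice-symmetry invariance of `P_p`, Grimmett 1999 §1.6). [folklore] -/
private theorem real_sdiff_image_refl (S A B B' : Set (Site 2)) :
    (bondPercolation (zdGraph 2) half).real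
        (openCrossing ((reflectIso (1 : Fin 2)).toEquiv '' S) ((reflectIso (1 : Fin 2)).toEquiv '' A)
            ((reflectIso (1 : Fin 2)).toEquiv '' B) \
          openCrossing ((reflectIso (1 : Fin 2)).toEquiv '' S) ((reflectIso (1 : Fin 2)).toEquiv '' A)
            ((reflectIso (1 : Fin 2)).toEquiv '' B')) =
      (bondPercolation (zdGraph 2) half).real (openCrossing S A B \ openCrossing S A B') := by
  rw [← preimage_relabel_openCrossing (reflectIso (1 : Fin 2)).toEquiv S A B,
    ← preimage_relabel_openCrossing (reflectIso (1 : Fin 2)).toEquiv S A B', ← Set.preimage_sdiff]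
  exact (bondPercolation_real_preimage_relabel_iso (reflectIso (1 : Fin 2)) half _).symm

/-! ### The stub -/

/-- **Stub stub_conjDensity (the closure density is reflection-invariant)** (registered signature,
verbatim). For the complex-conjugate copy `R'` of a conformal rectangle `R` (`z ∈ R'.carrier ↔
conj z ∈ R.carrier`, `R'.boundary = conj ∘ R.boundary`, same marks) and the lattice reflection
`σ v = (v₀, -v₁)`: `closureDensity R' δ (σ v) = closureDensity R δ v` for every mesh `δ` and vertex `v`
(all finsets of the construction are `σ`-images of those of `R`, and `P_{1/2}` on `ℤ²` is invariant
under the relabelling `ω ↦ σ '' ω`, Grimmett 1999 §1.6). [folklore] -/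
theorem stub_conjDensity :
    ∀ R R' : ConformalRectangle,
      ((∀ z : ℂ, z ∈ R'.carrier ↔ (starRingEnd ℂ) z ∈ R.carrier) ∧
          (∀ t : ℝ, R'.boundary t = (starRingEnd ℂ) (R.boundary t)) ∧ (∀ i : Fin 4, R'.mark i = R.mark i)) →
        ∀ (δ : ℝ) (v : Site 2), closureDensity R' δ ![v 0, -v 1] = closureDensity R δ v := by
  rintro R R' ⟨hcar, hbd, hmk⟩ δ v
  have hv : ({(reflectIso (1 : Fin 2)).toEquiv v} : Set (Site 2)) =
      (reflectIso (1 : Fin 2)).toEquiv '' {v} := (Set.image_singleton).symm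
  rw [← refl_apply v]
  unfold closureDensity
  rw [coe_eq_image_refl (mem_closureFinset_conj hcar hbd δ),
    coe_eq_image_refl (mem_rowArc_conj hcar hbd hmk δ),
    coe_eq_image_refl (mem_rowBeyond_conj hcar hbd hmk δ v), hv]
  exact real_sdiff_image_refl _ _ _ _

end Summit.CriticalPhenomena.CardyFormulaZ2.Cruxes.RectilinearCardy.ExcursionKernelCovariance

end
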